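import Literature.NumberTheory.GaloisRepresentations.IntegralGaloisActionProofs
import Literature.NumberTheory.NumberFields.FrobeniusOnRootsOfUnity
import HarnessLib

/-!
# Lifting an arithmetic Frobenius of `L/F₀` at `v` to `Aut(L̄/F₀)` as an arithmetic Frobenius at a
# prime `𝔓 ∣ v` of `\bar ℤ_L` (Neukirch I §9; Serre, *Abelian ℓ-adic representations* I §2.1;
# Shimura 1998, §11.1 proof of Prop. 14 «take an extension `𝔭′` of `𝔭`», §18.6 p. 128 (3))

Topic `Literature/NumberTheory/NumberFields`, namespace `Literature.NumberTheory.NumberFields`.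
THEOREMS ONLY (no definition, no named fact, no instance; net Literature debt 0).  Cell `hodgecm-mathlib`
(D-0151), row II-1 v2h, first step of the future `_holds` of the re-scoped joint fact II-1-S5c (B-plan1
2026-08-28T04:12:54Z (3) / 04:18:01Z «→ B-p06: take (b) the σ̃-LEMMA»): the fact PROVIDES an automorphism
`σ̃` of `L̄ = AlgebraicClosure L` with (σ-a) `σ̃|_L = γ` and (σ-b) `σ̃ ζ = ζ^q` on `ℓ`-power roots of unity;
this file CONSTRUCTS such a `σ̃`, indeed an arithmetic `q`-Frobenius at a prescribed prime `𝔓 ∣ v` of the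
ring `\bar ℤ_L = absIntegers (𝓞 L) L` of all algebraic integers of `L̄`, WITHOUT any unramifiedness hypothesis.

THE PRINT.  J. Neukirch, *Algebraic Number Theory*, Ch. I §9: Prop. (9.1) (transitivity of the Galois group
on the primes above `𝔭`), Prop. (9.4) (the decomposition group surjects onto the Galois group of the residue
extension), Def. (9.5)/Exercise 2 (Frobenius automorphism); J.-P. Serre, *Abelian ℓ-adic representations* (1968),
Ch. I §2.1 (Frobenius elements in `Gal(K̄/K)`); G. Shimura, *Abelian Varieties with Complex Multiplication…*
(1998), §11.1 proof of Prop. 14 (p. 83: «Take an extension `𝔭′` of `𝔭` in `k′`…») and §18.6 p. 128 condition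
(3) «`σ = [𝔓, L/K*]` on `L`» (an automorphism of `ℂ` inducing the Frobenius of `L`).

STATEMENT (`exists_algEquiv_algebraicClosure_lift_of_isArithFrobAt`).  Let `F₀ ⊆ L` be number fields,
`γ ∈ Aut(L/F₀)` an arithmetic Frobenius at the finite place `v` of `L` (`γ a ≡ a^q mod v`,
`q = #(𝓞_{F₀}/𝔭)`, `𝔭 = v ∩ F₀`; Mathlib `IsArithFrobAt`), and `𝔓` a prime of `\bar ℤ_L` above `v`.  Then
there is `σ̃ ∈ Aut(L̄/F₀)` with
* (σ-a) `σ̃ (a) = γ a` for `a ∈ L`;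
* (σ-c) `σ̃` maps `\bar ℤ_L` into itself and `σ̃ x ≡ x^q (mod 𝔓)` for all `x ∈ \bar ℤ_L`;
* (σ-b) `σ̃ ζ = ζ^q` for every root of unity `ζ ∈ L̄` of order `N` prime to `𝔭` (`(N : 𝓞_{F₀}) ∉ 𝔭`).
PROOF (B-plan1's recipe): lift `γ` to `γ̃₀ ∈ Aut(L̄/F₀)` (`AlgEquiv.liftNormal`); `γ̃₀(𝔓)` is again a prime
above `v` (`γ` fixes `v`), so `τ₀ γ̃₀(𝔓) = 𝔓` for some `τ₀ ∈ Gal(L̄/L)` (transitivity, the tree's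
`exists_smul_eq_of_mem_primesAbove_holds`); `γ̃ := τ₀ γ̃₀` stabilises `𝔓` and still lifts `γ`; the map
`δ : \bar ℤ_L/𝔓 → \bar ℤ_L/𝔓`, `ȳ ↦ (γ̃⁻¹ y)^q mod 𝔓`, is an automorphism over `𝓞_L/v` (well defined and
additive in characteristic `p ∣ q`, injective on the residue FIELD, surjective because `L̄` is algebraically
closed, and the identity on `𝓞_L/v` because `a ≡ (γ⁻¹ a)^q`), hence `δ = \bar τ` for some `τ` in the
decomposition group of `𝔓` in `Gal(L̄/L)` (Mathlib `Ideal.Quotient.stabilizerHom_surjective_of_profinite`, with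
the tree's `absIntegers.continuousSMul` / `absIntegers.isInvariant`); `σ̃ := τ γ̃` works:
`σ̃ x = τ(γ̃ x) ≡ δ(γ̃ x) = x^q`.  (σ-b) follows from (σ-c) by B-p12's `eq_of_pow_eq_one_of_sub_mem`.

## References
* [NeukirchANT1999] J. Neukirch, *Algebraic Number Theory* (1999), Ch. I §9, Props. (9.1), (9.4), Def. (9.5).
* [SerreAbelianLadic1968] J.-P. Serre, *Abelian ℓ-adic representations and elliptic curves* (1968), Ch. I §2.1.
* [Shimura1998] G. Shimura, *Abelian Varieties with Complex Multiplication and Modular Functions* (1998),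
  §11.1 proof of Prop. 14 (p. 83); §18.6 p. 128 (3).
-/

noncomputable section

open scoped Pointwise NumberField
open NumberField IsDedekindDomain Field
open Literature.NumberTheory.GaloisRepresentations

namespace Literature.NumberTheory.NumberFields

variable {F₀ L : Type} [Field F₀] [NumberField F₀] [Field L] [NumberField L] [Algebra F₀ L]

/-! ## §0 `L̄` over `F₀`; ring automorphisms of `L̄` preserve `\bar ℤ_L` -/

/-- `L̄ = AlgebraicClosure L` is an algebraic closure of `F₀` (through `F₀ ⊆ L`). [folklore] -/
private theorem isAlgClosure_algebraicClosure_tower : IsAlgClosure F₀ (AlgebraicClosure L) where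
  isAlgClosed := inferInstance
  isAlgebraic := Algebra.IsAlgebraic.trans F₀ L (AlgebraicClosure L)

/-- `L̄/F₀` is normal. [folklore] -/
private theorem normal_algebraicClosure_tower : Normal F₀ (AlgebraicClosure L) :=
  haveI := isAlgClosure_algebraicClosure_tower (F₀ := F₀) (L := L)
  IsAlgClosure.normal F₀ (AlgebraicClosure L)

omit [NumberField L] in
/-- A ring automorphism of `L̄` preserves the ring `\bar ℤ_L` of algebraic integers (integrality over `ℤ`
is preserved; `\bar ℤ_L` = integral closure of `𝓞_L` = of `ℤ`). [cite: NeukirchANT1999, Ch. I §9 (σ𝒪 = 𝒪 for σ ∈ G)] -/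
theorem ringEquiv_apply_mem_absIntegers (e : AlgebraicClosure L ≃+* AlgebraicClosure L)
    {x : AlgebraicClosure L} (hx : x ∈ absIntegers (𝓞 L) L) : e x ∈ absIntegers (𝓞 L) L := by
  -- integral over `𝓞 L` ⟺ integral over `ℤ`, and `e` preserves integrality over `ℤ`
  have h1 : IsIntegral ℤ x := isIntegral_trans (R := ℤ) (A := 𝓞 L) x (mem_integralClosure_iff _ _ |>.mp hx)
  have h2 : IsIntegral ℤ (e x) := map_isIntegral_int e.toRingHom h1
  exact mem_integralClosure_iff _ _ |>.mpr h2.tower_top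


omit [NumberField L] in
/-- **Restriction of a ring automorphism of `L̄` to `\bar ℤ_L`**: every `e ∈ Aut(L̄)` induces a ring automorphism
`g` of `\bar ℤ_L` with `g x = e x` (Neukirch I §9: `σ𝒪 = 𝒪`). [cite: NeukirchANT1999, Ch. I §9 (before Prop. (9.1))] -/
theorem exists_ringEquiv_absIntegers_coe_eq (e : AlgebraicClosure L ≃+* AlgebraicClosure L) :
    ∃ g : absIntegers (𝓞 L) L ≃+* absIntegers (𝓞 L) L,
      (∀ x : absIntegers (𝓞 L) L, (g x : AlgebraicClosure L) = e x) ∧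
      ∀ x : absIntegers (𝓞 L) L, (g.symm x : AlgebraicClosure L) = e.symm x := by
  refine ⟨{ toFun := fun x => ⟨e x, ringEquiv_apply_mem_absIntegers e x.2⟩
            invFun := fun x => ⟨e.symm x, ringEquiv_apply_mem_absIntegers e.symm x.2⟩
            left_inv := fun x => Subtype.ext (e.symm_apply_apply x)
            right_inv := fun x => Subtype.ext (e.apply_symm_apply x)
            map_mul' := fun x y => Subtype.ext (by simp)
            map_add' := fun x y => Subtype.ext (by simp) }, fun x => rfl, fun x => rfl⟩

omit [NumberField L] in
/-- `(algebraMap (𝓞 L) \bar ℤ_L a : L̄) = algebraMap L L̄ a`. [folklore] -/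
private theorem coe_algebraMap_absIntegers (a : 𝓞 L) :
    ((algebraMap (𝓞 L) (absIntegers (𝓞 L) L) a : absIntegers (𝓞 L) L) : AlgebraicClosure L) =
      algebraMap L (AlgebraicClosure L) (a : L) := by
  rw [Subalgebra.coe_algebraMap]
  exact IsScalarTower.algebraMap_apply (𝓞 L) L (AlgebraicClosure L) a

/-! ## §1 A lift of `γ` to `Aut(L̄/F₀)` stabilising `𝔓` (transitivity) -/

omit [NumberField F₀] [NumberField L] in
/-- **An arithmetic Frobenius `γ` at `v` stabilises `v`** (`γ(v) = v`): `a ∈ v ↔ γ a ∈ v`. [cite: NeukirchANT1999, Ch. I §9 Def. (9.5)] -/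
theorem mem_iff_smul_mem_of_isArithFrobAt (γ : L ≃ₐ[F₀] L) {v : HeightOneSpectrum (𝓞 L)}
    (hγ : IsArithFrobAt (𝓞 F₀) γ v.asIdeal) (a : 𝓞 L) : a ∈ v.asIdeal ↔ γ • a ∈ v.asIdeal := by
  have h := hγ.comap_eq
  constructor
  · intro ha
    -- `γ • a ≡ a ^ q (mod v)` and `a ^ q ∈ v`
    have h1 := hγ a
    rw [MulSemiringAction.toAlgHom_apply] at h1
    have h2 : a ^ Nat.card (𝓞 F₀ ⧸ Ideal.under (𝓞 F₀) v.asIdeal) ∈ v.asIdeal :=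
      Ideal.pow_mem_of_mem v.asIdeal ha _ hγ.card_pos
    simpa using v.asIdeal.add_mem h1 h2
  · intro ha
    have : a ∈ Ideal.comap (MulSemiringAction.toAlgHom (𝓞 F₀) (𝓞 L) γ) v.asIdeal := by
      rw [Ideal.mem_comap, MulSemiringAction.toAlgHom_apply]
      exact ha
    rwa [h] at this

/-- **A lift `γ̃ ∈ Aut(L̄/F₀)` of `γ` STABILISING the prime `𝔓 ∣ v` of `\bar ℤ_L`**: lift `γ` to `γ̃₀`
(`AlgEquiv.liftNormal`, `L̄/F₀` normal); `γ̃₀(𝔓)` is a prime above `γ(v) = v`, so `τ₀ γ̃₀(𝔓) = 𝔓` for some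
`τ₀ ∈ Gal(L̄/L)` (transitivity, Neukirch I (9.1) in the limit = the tree's `exists_smul_eq_of_mem_primesAbove_holds`);
`γ̃ := τ₀ γ̃₀`.  Output: `γ̃` with `γ̃|_L = γ` and a ring automorphism `g` of `\bar ℤ_L`, `g = γ̃` on elements, with
`g x ∈ 𝔓 ↔ x ∈ 𝔓`. [cite: NeukirchANT1999, Ch. I §9 Prop. (9.1)] [cite: SerreAbelianLadic1968, Ch. I §2.1] -/
theorem exists_algEquiv_lift_stabilizing (γ : L ≃ₐ[F₀] L) (v : HeightOneSpectrum (𝓞 L))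
    (hγ : IsArithFrobAt (𝓞 F₀) γ v.asIdeal) {𝔓 : Ideal (absIntegers (𝓞 L) L)} (h𝔓 : 𝔓 ∈ v.primesAbove) :
    ∃ (γt : AlgebraicClosure L ≃ₐ[F₀] AlgebraicClosure L) (g : absIntegers (𝓞 L) L ≃+* absIntegers (𝓞 L) L),
      (∀ a : L, γt (algebraMap L (AlgebraicClosure L) a) = algebraMap L (AlgebraicClosure L) (γ a)) ∧
      (∀ x : absIntegers (𝓞 L) L, (g x : AlgebraicClosure L) = γt x) ∧
      (∀ x : absIntegers (𝓞 L) L, g x ∈ 𝔓 ↔ x ∈ 𝔓) ∧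
      ∀ a : 𝓞 L, g.symm (algebraMap (𝓞 L) (absIntegers (𝓞 L) L) a) =
        algebraMap (𝓞 L) (absIntegers (𝓞 L) L) (γ⁻¹ • a) := by
  haveI := normal_algebraicClosure_tower (F₀ := F₀) (L := L)
  -- (1) a lift `γ̃₀`
  let γ₀ : AlgebraicClosure L ≃ₐ[F₀] AlgebraicClosure L := γ.liftNormal (AlgebraicClosure L)
  have hγ₀ : ∀ a : L, γ₀ (algebraMap L (AlgebraicClosure L) a) = algebraMap L (AlgebraicClosure L) (γ a) :=
    fun a => γ.liftNormal_commutes (AlgebraicClosure L) a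
  have hγ₀' : ∀ a : L, γ₀.symm (algebraMap L (AlgebraicClosure L) a) =
      algebraMap L (AlgebraicClosure L) (γ.symm a) := fun a => by
    rw [AlgEquiv.symm_apply_eq, hγ₀, AlgEquiv.apply_symm_apply]
  obtain ⟨g₀, hg₀, hg₀'⟩ := exists_ringEquiv_absIntegers_coe_eq (L := L) γ₀.toRingEquiv
  -- (2) the prime `𝔓₁ = γ̃₀(𝔓)` lies above `v`
  haveI := h𝔓.1
  let 𝔓₁ : Ideal (absIntegers (𝓞 L) L) := 𝔓.comap g₀.symm.toRingHom
  have hmem₁ : ∀ y : absIntegers (𝓞 L) L, y ∈ 𝔓₁ ↔ g₀.symm y ∈ 𝔓 := fun y => Iff.rfl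
  have hγ₀'' : ∀ a : L, γ₀.symm (algebraMap L (AlgebraicClosure L) a) =
      algebraMap L (AlgebraicClosure L) ((γ⁻¹ : L ≃ₐ[F₀] L) a) := hγ₀'
  have hga : ∀ a : 𝓞 L, g₀.symm (algebraMap (𝓞 L) (absIntegers (𝓞 L) L) a) =
      algebraMap (𝓞 L) (absIntegers (𝓞 L) L) (γ⁻¹ • a) := fun a => by
    apply Subtype.ext
    rw [hg₀', coe_algebraMap_absIntegers, coe_algebraMap_absIntegers]
    exact hγ₀'' (a : L)
  have h𝔓₁ : 𝔓₁ ∈ v.primesAbove := by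
    refine ⟨Ideal.IsPrime.comap _, ⟨?_⟩⟩
    ext a
    -- `a ∈ v ↔ γ⁻¹ a ∈ v ↔ g₀⁻¹ (a) ∈ 𝔓 ↔ a ∈ 𝔓₁`
    have e1 : a ∈ Ideal.under (𝓞 L) 𝔓₁ ↔ γ⁻¹ • a ∈ v.asIdeal := by
      change g₀.symm (algebraMap (𝓞 L) (absIntegers (𝓞 L) L) a) ∈ 𝔓 ↔ _
      rw [hga, h𝔓.2.over]
      rfl
    rw [e1, mem_iff_smul_mem_of_isArithFrobAt γ hγ (γ⁻¹ • a), smul_smul, mul_inv_cancel, one_smul]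
  -- (3) transitivity
  obtain ⟨τ₀, hτ₀⟩ := v.exists_smul_eq_of_mem_primesAbove_holds h𝔓₁ h𝔓
  let τ₀' : AlgebraicClosure L ≃ₐ[L] AlgebraicClosure L := τ₀
  refine ⟨γ₀.trans (τ₀'.restrictScalars F₀), g₀.trans (MulSemiringAction.toRingEquiv _ _ τ₀),
    fun a => ?_, fun x => ?_, fun x => ?_, fun a => ?_⟩
  · rw [AlgEquiv.trans_apply, hγ₀, AlgEquiv.restrictScalars_apply]
    exact τ₀'.commutes (γ a)
  · change ((τ₀ • g₀ x : absIntegers (𝓞 L) L) : AlgebraicClosure L) = τ₀' (γ₀ x)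
    rw [integralClosure.coe_smul, hg₀]
    rfl
  · change τ₀ • g₀ x ∈ 𝔓 ↔ x ∈ 𝔓
    conv_lhs => rw [← hτ₀, Ideal.mem_pointwise_smul_iff_inv_smul_mem, inv_smul_smul, hmem₁,
      RingEquiv.symm_apply_apply]
  · change g₀.symm (τ₀⁻¹ • algebraMap (𝓞 L) (absIntegers (𝓞 L) L) a) = _
    rw [smul_algebraMap, hga]


/-! ## §2–§3 The residual correction and the lift `σ̃` -/

/-- **Lifting an arithmetic Frobenius to `Aut(L̄/F₀)` as an arithmetic Frobenius at a prescribed `𝔓 ∣ v`.**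
For number fields `F₀ ⊆ L`, `γ ∈ Aut(L/F₀)` with `γ a ≡ a^q (mod v)` (`q = #(𝓞_{F₀}/𝔭)`, `𝔭 = v ∩ F₀`) and a
prime `𝔓` of `\bar ℤ_L` above `v`, there is `σ̃ ∈ Aut(L̄/F₀)` with (σ-a) `σ̃|_L = γ`, (σ-c) `σ̃(\bar ℤ_L) ⊆ \bar ℤ_L`
and `σ̃ x ≡ x^q (mod 𝔓)` on `\bar ℤ_L`, (σ-b) `σ̃ ζ = ζ^q` for roots of unity of order prime to `𝔭`.  (Neukirch I
(9.1), (9.4): transitivity and `G_𝔓 ↠ G(κ(𝔓)|κ(𝔭))`, in the profinite limit as in Mathlib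
`Ideal.Quotient.stabilizerHom_surjective_of_profinite`; Shimura's extension `𝔭′` of `𝔭` and `σ` with `σ = [𝔓, L/K*]`
on `L`.)  No unramifiedness of `v` is assumed. [cite: NeukirchANT1999, Ch. I §9 Props. (9.1), (9.4), Def. (9.5)]
[cite: SerreAbelianLadic1968, Ch. I §2.1] [cite: Shimura1998, §11.1 proof of Prop. 14 (p. 83) and §18.6 p. 128 (3)] -/
theorem exists_algEquiv_algebraicClosure_lift_of_isArithFrobAt (γ : L ≃ₐ[F₀] L) (v : HeightOneSpectrum (𝓞 L))
    (hγ : IsArithFrobAt (𝓞 F₀) γ v.asIdeal) {𝔓 : Ideal (absIntegers (𝓞 L) L)} (h𝔓 : 𝔓 ∈ v.primesAbove) :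
    ∃ σt : AlgebraicClosure L ≃ₐ[F₀] AlgebraicClosure L,
      (∀ a : L, σt (algebraMap L (AlgebraicClosure L) a) = algebraMap L (AlgebraicClosure L) (γ a)) ∧
      (∀ x : absIntegers (𝓞 L) L, ∃ hx : σt x ∈ absIntegers (𝓞 L) L,
        (⟨σt x, hx⟩ : absIntegers (𝓞 L) L) - x ^ Nat.card (𝓞 F₀ ⧸ v.asIdeal.under (𝓞 F₀)) ∈ 𝔓) ∧
      ∀ N : ℕ, (N : 𝓞 F₀) ∉ v.asIdeal.under (𝓞 F₀) →
        ∀ ζ : AlgebraicClosure L, ζ ^ N = 1 → σt ζ = ζ ^ Nat.card (𝓞 F₀ ⧸ v.asIdeal.under (𝓞 F₀)) := by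
  classical
  haveI := h𝔓.1
  haveI : 𝔓.IsMaximal := v.isMaximal_of_mem_primesAbove h𝔓
  haveI : 𝔓.LiesOver v.asIdeal := h𝔓.2
  letI : TopologicalSpace (absIntegers (𝓞 L) L) := ⊥
  haveI : DiscreteTopology (absIntegers (𝓞 L) L) := ⟨rfl⟩
  haveI := absIntegers.continuousSMul (𝓞 L) (K := L)
  haveI := absIntegers.isInvariant (𝓞 L) (K := L)
  obtain ⟨γt, g, hγt, hg, hg𝔓, hgL⟩ := exists_algEquiv_lift_stabilizing γ v hγ h𝔓
  have hqpos : 0 < Nat.card (𝓞 F₀ ⧸ v.asIdeal.under (𝓞 F₀)) := hγ.card_pos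
  -- characteristic bookkeeping: `q = p ^ n`, `char (\bar ℤ_L ⧸ 𝔓) = p`
  haveI : (v.asIdeal.under (𝓞 F₀)).IsMaximal := Ideal.IsMaximal.under (𝓞 F₀) v.asIdeal
  haveI : Finite (𝓞 F₀ ⧸ v.asIdeal.under (𝓞 F₀)) := hγ.finite_quotient
  letI : Fintype (𝓞 F₀ ⧸ v.asIdeal.under (𝓞 F₀)) := Fintype.ofFinite _
  letI : Field (𝓞 F₀ ⧸ v.asIdeal.under (𝓞 F₀)) := Ideal.Quotient.field _
  obtain ⟨p, hcharp, n, hp, hcard⟩ := FiniteField.card' (𝓞 F₀ ⧸ v.asIdeal.under (𝓞 F₀))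
  haveI := hcharp
  haveI : Fact p.Prime := ⟨hp⟩
  have hqpn : Nat.card (𝓞 F₀ ⧸ v.asIdeal.under (𝓞 F₀)) = p ^ (n : ℕ) := by
    rw [Nat.card_eq_fintype_card, hcard]
  haveI : CharP (𝓞 L ⧸ v.asIdeal) p :=
    charP_of_injective_algebraMap' (𝓞 F₀ ⧸ v.asIdeal.under (𝓞 F₀)) p
  haveI : CharP (absIntegers (𝓞 L) L ⧸ 𝔓) p := charP_of_injective_algebraMap' (𝓞 L ⧸ v.asIdeal) p
  -- the map `x ↦ (g⁻¹ x)^q mod 𝔓` is a ring homomorphism `B → B ⧸ 𝔓` killing `𝔓`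
  let φ : absIntegers (𝓞 L) L →+* absIntegers (𝓞 L) L ⧸ 𝔓 :=
    { toFun := fun x => Ideal.Quotient.mk 𝔓 (g.symm x ^ Nat.card (𝓞 F₀ ⧸ v.asIdeal.under (𝓞 F₀)))
      map_one' := by simp
      map_mul' := fun x y => by rw [map_mul, mul_pow, map_mul]
      map_zero' := by rw [map_zero, zero_pow hqpos.ne', map_zero]
      map_add' := fun x y => by
        rw [map_add, map_pow, map_pow, map_pow, map_add, hqpn, add_pow_char_pow] }
  have hφ : ∀ x : absIntegers (𝓞 L) L, φ x = Ideal.Quotient.mk 𝔓 (g.symm x ^ Nat.card (𝓞 F₀ ⧸ v.asIdeal.under (𝓞 F₀))) := fun x => rfl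
  have hφker : ∀ x ∈ 𝔓, φ x = 0 := fun x hx => by
    rw [hφ, Ideal.Quotient.eq_zero_iff_mem]
    exact Ideal.pow_mem_of_mem 𝔓 ((hg𝔓 (g.symm x)).1 (by rwa [RingEquiv.apply_symm_apply])) _ hqpos
  let δ₀ : absIntegers (𝓞 L) L ⧸ 𝔓 →+* absIntegers (𝓞 L) L ⧸ 𝔓 := Ideal.Quotient.lift 𝔓 φ hφker
  have hδ₀ : ∀ x : absIntegers (𝓞 L) L, δ₀ (Ideal.Quotient.mk 𝔓 x) = Ideal.Quotient.mk 𝔓 (g.symm x ^ Nat.card (𝓞 F₀ ⧸ v.asIdeal.under (𝓞 F₀))) := fun x =>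
    Ideal.Quotient.lift_mk 𝔓 φ hφker
  -- `δ` is the identity on `𝓞 L ⧸ v`: `a ≡ (γ⁻¹ a)^q (mod v)`
  have hδ₀alg : ∀ r : 𝓞 L ⧸ v.asIdeal, δ₀ (algebraMap (𝓞 L ⧸ v.asIdeal) (absIntegers (𝓞 L) L ⧸ 𝔓) r) =
      algebraMap (𝓞 L ⧸ v.asIdeal) (absIntegers (𝓞 L) L ⧸ 𝔓) r := by
    intro r
    obtain ⟨a, rfl⟩ := Ideal.Quotient.mk_surjective r
    rw [Ideal.Quotient.algebraMap_mk_of_liesOver, hδ₀, hgL, ← map_pow, Ideal.Quotient.eq,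
      ← map_sub, ← Ideal.mem_comap]
    change (γ⁻¹ • a) ^ Nat.card (𝓞 F₀ ⧸ v.asIdeal.under (𝓞 F₀)) - a ∈ Ideal.under (𝓞 L) 𝔓
    rw [← h𝔓.2.over]
    have h1 := hγ (γ⁻¹ • a)
    rw [MulSemiringAction.toAlgHom_apply, smul_smul, mul_inv_cancel, one_smul] at h1
    -- `h1 : a - (γ⁻¹ • a)^q ∈ v`
    rw [← neg_sub]
    exact v.asIdeal.neg_mem h1
  let δalg : (absIntegers (𝓞 L) L ⧸ 𝔓) →ₐ[𝓞 L ⧸ v.asIdeal] (absIntegers (𝓞 L) L ⧸ 𝔓) := { δ₀ with commutes' := hδ₀alg }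
  -- `δ` is bijective: injective (a field), surjective (`q`-th roots exist in `L̄` and are integral)
  letI : Field (absIntegers (𝓞 L) L ⧸ 𝔓) := Ideal.Quotient.field 𝔓
  have hδbij : Function.Bijective δalg := by
    refine ⟨δ₀.injective, fun z => ?_⟩
    obtain ⟨y, rfl⟩ := Ideal.Quotient.mk_surjective z
    obtain ⟨w, hw⟩ := IsAlgClosed.exists_pow_nat_eq (y : AlgebraicClosure L) hqpos
    have hwB : w ∈ absIntegers (𝓞 L) L := by
      refine mem_integralClosure_iff _ _ |>.mpr (IsIntegral.of_pow hqpos ?_)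
      rw [hw]
      exact mem_integralClosure_iff _ _ |>.mp y.2
    refine ⟨Ideal.Quotient.mk 𝔓 (g ⟨w, hwB⟩), ?_⟩
    change δ₀ _ = _
    rw [hδ₀, RingEquiv.symm_apply_apply]
    exact congrArg _ (Subtype.ext hw)
  let δ : (absIntegers (𝓞 L) L ⧸ 𝔓) ≃ₐ[𝓞 L ⧸ v.asIdeal] (absIntegers (𝓞 L) L ⧸ 𝔓) := AlgEquiv.ofBijective δalg hδbij
  have hδ : ∀ x : absIntegers (𝓞 L) L, δ (Ideal.Quotient.mk 𝔓 x) = Ideal.Quotient.mk 𝔓 (g.symm x ^ Nat.card (𝓞 F₀ ⧸ v.asIdeal.under (𝓞 F₀))) := fun x => hδ₀ x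
  -- Neukirch (9.4) in the limit: `δ = \bar τ` for some `τ` in the decomposition group of `𝔓`
  obtain ⟨τ, hτ⟩ := Ideal.Quotient.stabilizerHom_surjective_of_profinite
    (G := absoluteGaloisGroup L) v.asIdeal 𝔓 δ
  have hτx : ∀ y : absIntegers (𝓞 L) L, Ideal.Quotient.mk 𝔓 (τ • y) = Ideal.Quotient.mk 𝔓 (g.symm y ^ Nat.card (𝓞 F₀ ⧸ v.asIdeal.under (𝓞 F₀))) := fun y => by
    rw [← hδ, ← hτ, Ideal.Quotient.stabilizerHom_apply]
  -- the lift `σ̃ := τ ∘ γ̃`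
  let τ' : AlgebraicClosure L ≃ₐ[L] AlgebraicClosure L := (τ : absoluteGaloisGroup L)
  have hτ'B : ∀ y : absIntegers (𝓞 L) L, ((τ • y : absIntegers (𝓞 L) L) : AlgebraicClosure L) = τ' y := fun y => by
    rw [integralClosure.coe_smul]
    rfl
  refine ⟨γt.trans (τ'.restrictScalars F₀), fun a => ?_, fun x => ?_, fun N hN ζ hζ => ?_⟩
  · -- (σ-a)
    rw [AlgEquiv.trans_apply, hγt, AlgEquiv.restrictScalars_apply]
    exact τ'.commutes (γ a)
  · -- (σ-c)
    have hval : (γt.trans (τ'.restrictScalars F₀)) x = ((τ • g x : absIntegers (𝓞 L) L) : AlgebraicClosure L) := by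
      rw [AlgEquiv.trans_apply, AlgEquiv.restrictScalars_apply, hτ'B, hg]
    refine ⟨hval ▸ (τ • g x).2, ?_⟩
    have hxeq : (⟨(γt.trans (τ'.restrictScalars F₀)) x, hval ▸ (τ • g x).2⟩ : absIntegers (𝓞 L) L) = τ • g x :=
      Subtype.ext hval
    rw [hxeq, ← Ideal.Quotient.eq, hτx, RingEquiv.symm_apply_apply]
  · -- (σ-b): roots of unity of order prime to `𝔭`
    have hN0 : 0 < N := by
      rcases Nat.eq_zero_or_pos N with h | h
      · exfalso
        apply hN
        rw [h, Nat.cast_zero]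
        exact zero_mem _
      · exact h
    have hζB : ζ ∈ absIntegers (𝓞 L) L := mem_integralClosure_iff _ _ |>.mpr
      (IsIntegral.of_pow hN0 (by rw [hζ]; exact isIntegral_one))
    set z : absIntegers (𝓞 L) L := ⟨ζ, hζB⟩ with hz
    -- from (σ-c) at `z`
    have hval : (γt.trans (τ'.restrictScalars F₀)) ζ = ((τ • g z : absIntegers (𝓞 L) L) : AlgebraicClosure L) := by
      rw [AlgEquiv.trans_apply, AlgEquiv.restrictScalars_apply, hτ'B, hg]
    have hcong : (τ • g z : absIntegers (𝓞 L) L) - z ^ Nat.card (𝓞 F₀ ⧸ v.asIdeal.under (𝓞 F₀)) ∈ 𝔓 := by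
      rw [← Ideal.Quotient.eq, hτx, RingEquiv.symm_apply_apply]
    have hNB : ((N : ℕ) : absIntegers (𝓞 L) L) ∉ 𝔓 := by
      intro hmem
      apply hN
      have h1 : (algebraMap (𝓞 L) (absIntegers (𝓞 L) L) (N : 𝓞 L)) ∈ 𝔓 := by rwa [map_natCast]
      have h2 : ((N : ℕ) : 𝓞 L) ∈ v.asIdeal := by
        rw [h𝔓.2.over]
        exact h1
      have h3 : algebraMap (𝓞 F₀) (𝓞 L) (N : 𝓞 F₀) ∈ v.asIdeal := by rwa [map_natCast]
      exact h3
    have h1 : (τ • g z : absIntegers (𝓞 L) L) ^ N = 1 := by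
      have : z ^ N = 1 := Subtype.ext (by rw [hz]; exact hζ)
      rw [← smul_pow', ← map_pow, this, map_one, smul_one]
    have h2 : (z ^ Nat.card (𝓞 F₀ ⧸ v.asIdeal.under (𝓞 F₀))) ^ N = 1 := by
      rw [← pow_mul, mul_comm, pow_mul]
      have : z ^ N = 1 := Subtype.ext (by rw [hz]; exact hζ)
      rw [this, one_pow]
    have heq := eq_of_pow_eq_one_of_sub_mem hNB h1 h2 hcong
    rw [hval, heq]
    rfl


/-- **The shape consumed by S5/S7 of the `hodgecm-mathlib` cell** (B-p20's binders `σ`, `hσ`, `_hσζ` of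
`StubPolarisationTransport` v2g / clause (σ-a)(σ-b) of the II-1-S5c fact): for `γ ∈ Aut(L/F₀)` an arithmetic
Frobenius at `v` with `#(𝓞_{F₀}/𝔭) = p ^ n` and a prime `ℓ` not under `𝔭`, there is a ring automorphism `σ` of
`L̄` extending `γ` with `σ ζ = ζ ^ (p ^ n)` for all `ℓ`-power roots of unity `ζ`. [cite: Shimura1998, §18.6 p. 128 (3) and §11.1 proof of Prop. 14 (p. 83)]
[cite: NeukirchANT1999, Ch. I §9 Props. (9.1), (9.4)] -/
theorem exists_ringEquiv_algebraicClosure_lift_pow_of_isArithFrobAt (γ : L ≃ₐ[F₀] L)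
    (v : HeightOneSpectrum (𝓞 L)) (hγ : IsArithFrobAt (𝓞 F₀) γ v.asIdeal) (p n : ℕ)
    (hq : Nat.card (𝓞 F₀ ⧸ v.asIdeal.under (𝓞 F₀)) = p ^ n) (ℓ : ℕ)
    (hℓ : (ℓ : 𝓞 F₀) ∉ v.asIdeal.under (𝓞 F₀)) :
    ∃ σ : AlgebraicClosure L ≃+* AlgebraicClosure L,
      (∀ a : L, σ (algebraMap L (AlgebraicClosure L) a) = algebraMap L (AlgebraicClosure L) (γ a)) ∧
      ∀ (k : ℕ) (ζ : AlgebraicClosure L), ζ ^ (ℓ ^ k) = 1 → σ ζ = ζ ^ (p ^ n) := by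
  obtain ⟨𝔓, h𝔓⟩ := v.primesAbove_nonempty
  obtain ⟨σt, hσa, -, hσb⟩ := exists_algEquiv_algebraicClosure_lift_of_isArithFrobAt γ v hγ h𝔓
  refine ⟨σt.toRingEquiv, fun a => hσa a, fun k ζ hζ => ?_⟩
  have hℓk : ((ℓ ^ k : ℕ) : 𝓞 F₀) ∉ v.asIdeal.under (𝓞 F₀) := by
    rw [Nat.cast_pow]
    exact fun h => hℓ (Ideal.IsPrime.mem_of_pow_mem inferInstance k h)
  rw [← hq]
  exact hσb (ℓ ^ k) hℓk ζ hζ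

end Literature.NumberTheory.NumberFields

end
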